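import Literature.Geometry.Lorentzian.ChartCalculus
import HarnessLib

/-!
# Maps into the tangent bundle of an open subset of a vector space

Topic `Geometry/Riemannian` (chart calculus, `OpensChart` setting). For `U : Opens V` the tangent
bundle `TU` is trivialised by the identity (`OpensChart.trivializationAt_apply`), so a map
`x ↦ (P x, W x) ∈ TU` from a manifold `X` — a vector field along `P : X → U` read as a map
`W : X → V` — is `C^n` at `x₀` iff `P` and `W` are (`contMDiffAt_opensLift_iff`,
`contMDiff_opensLift_iff`). This is the smoothness criterion for the presentations
`v ↦ (ι v, ν v) ∈ TU` of hypersurfaces of the model open set fed to the cone-map layer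
(`ConeRadialIsometry.lean`, hypothesis `hs`) in the interior surgery of Weinstein's disk.

## References

* B. O'Neill, *Semi-Riemannian Geometry* (1983), Ch. 1 (tangent bundle of an open subset of
  `ℝⁿ`). [cite: ONeill1983, Ch. 1]
* A. Weinstein, Ann. of Math. (2) 87 (1968), 29–41. [cite: Weinstein1968]

Tags: [ChartCalculus] [TangentBundle] [Weinstein1968]
-/

noncomputable section

open Bundle Set Function TopologicalSpace
open scoped Manifold ContDiff Topology

namespace Literature.Geometry.Riemannian

open Literature.Geometry.Lorentzian
open Literature.Geometry.Lorentzian.OpensChart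

variable {V : Type*} [NormedAddCommGroup V] [NormedSpace ℝ V] {U : Opens V}
  {EX : Type*} [NormedAddCommGroup EX] [NormedSpace ℝ EX] {HX : Type*} [TopologicalSpace HX]
  {IX : ModelWithCorners ℝ EX HX} {X : Type*} [TopologicalSpace X] [ChartedSpace HX X]
  {m : WithTop ℕ∞}

/-- **A map into `TU`, `U` open in a vector space, is `C^m` iff its base map and its fibre part
are**: `x ↦ (P x, W x) ∈ TU` is `C^m` at `x₀` iff `P : X → U` and `W : X → V` are `C^m` at `x₀`
(identity trivialisation of `TU`, `Bundle.contMDiffAt_totalSpace`). [folklore] -/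
theorem contMDiffAt_opensLift_iff {P : X → U} {W : X → V} {x₀ : X} :
    ContMDiffAt IX 𝓘(ℝ, V).tangent m
        (fun x ↦ (TotalSpace.mk' V (P x) (W x : TangentSpace 𝓘(ℝ, V) (P x)) :
          TangentBundle 𝓘(ℝ, V) U)) x₀ ↔
      ContMDiffAt IX 𝓘(ℝ, V) m P x₀ ∧ ContMDiffAt IX 𝓘(ℝ, V) m W x₀ := by
  rw [ModelWithCorners.tangent, Bundle.contMDiffAt_totalSpace]
  have hfib : (fun x ↦ ((trivializationAt V (TangentSpace 𝓘(ℝ, V) : U → Type _) (P x₀))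
      (TotalSpace.mk' V (P x) (W x : TangentSpace 𝓘(ℝ, V) (P x)) : TangentBundle 𝓘(ℝ, V) U)).2) =
      W := by
    funext x
    rw [OpensChart.trivializationAt_apply]
  simp only [hfib]

/-- Global version of `contMDiffAt_opensLift_iff`. [folklore] -/
theorem contMDiff_opensLift_iff {P : X → U} {W : X → V} :
    ContMDiff IX 𝓘(ℝ, V).tangent m
        (fun x ↦ (TotalSpace.mk' V (P x) (W x : TangentSpace 𝓘(ℝ, V) (P x)) :
          TangentBundle 𝓘(ℝ, V) U)) ↔
      ContMDiff IX 𝓘(ℝ, V) m P ∧ ContMDiff IX 𝓘(ℝ, V) m W := by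
  constructor
  · intro h
    exact ⟨fun x ↦ (contMDiffAt_opensLift_iff.1 (h x)).1, fun x ↦ (contMDiffAt_opensLift_iff.1 (h x)).2⟩
  · rintro ⟨hP, hW⟩ x
    exact contMDiffAt_opensLift_iff.2 ⟨hP x, hW x⟩

end Literature.Geometry.Riemannian

end
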